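import Literature.AnabelianGeometry.EtaleTheta.SettingModelChiProp15iiQuot
import Literature.AnabelianGeometry.EtaleTheta.SettingModelTateInvClauses
import HarnessLib

/-!
# [EtTh] Thm. 1.6 (iii) «tempered anabelian rigidity of the étale theta function» WITNESSED at `γ := ι` (the
# inversion) at both χ-models, for étale theta data with a NON-TRIVIAL class (proof-only)

Mochizuki, *The étale theta function …*, Publ. RIMS **45** (2009) [EtTh], Thm. 1.6 (iii) p. 24 («γ preserves the
étale theta classes up to a Π^tp_X/Π^tp_Y ≅ Z-conjugate»), Prop. 1.5 (iii) p. 23 [cite: MochizukiEtTh2009, Thm 1.6 (iii) p.24].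
abc-iut cell, layer L2, prover abc-iut-L2-d1 (gen 5); PROOF-ONLY census closer.  abc-iut-L2-t1's junction
`InvClauses.thm16iii_self` (`ThetaCohomologyInversion`: the typed `ThetaSetting.Thm16iii γ _ c Eα Eβ hC` at `γ = ι`,
`α = β`, `σ = 1`) and `InvClauses.thetaLift_fixed` (the K3-capstone binder shape `hιx`/`hιy` at `γ = ι`), applied to this
seat's model witnesses:
* stage 1 (`modelχ p`, twisted inversion, every companion, `E := etaleThetaDataχSec p (etaDdχ p)`, `etaDd ≠ 1`;
  `invClauses_modelχ`, abc-iut-f-150's `compat_modelχ`): **`thm16iii_twistedInversion_modelχ`**, `thetaLift_fixed_modelχ`;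
* stage 2 (`modelχq p i j hj` with `j = 2i`, cocycle-corrected inversion, every Galois section `s`, every companion,
  `E_s := (kummerCoreχq …).toKummerDataOfSection s … |>.etaleThetaDataOfClass (etaDdχq …)`; `invClauses_modelχq_ofSection`,
  abc-iut-f-149's `compat_modelχq`): **`thm16iii_inversionχq_ofSection`**, and the instance of record `(1, 2)`, `s := inr`:
  **`thm16iii_inversionχq_modelTate_inr`**;
* NV `ThetaSetting.exists_isEtThOrigin_thm16iii_ne_one`: SOME theta setting of [EtTh] origin carries étale theta data with
  `η̈^Θ ≠ 1` and an automorphism `γ` (with `Thm16i γ` and a theta companion) for which the typed Thm. 1.6 (iii) HOLDS.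
So far the typed `Thm16iii` was inhabited in the tree only through the K3 capstone's binders or at degenerate data; here it
is a closed theorem at a model with arithmetic content.  SEMI-SYNTHETIC MODELS, consistency evidence only; nothing of
[EtTh] asserted; no side taken on [IUTchIII] Cor. 3.12.
-/

noncomputable section

namespace Literature.AnabelianGeometry.EtaleTheta.SettingModel

open Literature.AnabelianGeometry.SemiGraphs _root_.Function

variable (p : ℕ) [Fact p.Prime]

/-! ### Stage 1: the χ-model and its twisted inversion -/

section StageOne

variable (cι : ThetaSetting.ThetaCompanion (Dα := ThetaSetting.modelχ p) (Dβ := ThetaSetting.modelχ p)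
    (twistedInversionTop (chi p) (isInducing_leftRightχ p)))

/-- **[EtTh] Thm. 1.6 (iii) HOLDS at `γ := ι` (the twisted inversion of the χ-model), `α = β = modelχ`**, for the section
datum carrying the non-trivial class `etaDdχ` and EVERY theta companion: the transported theta classes are the
(`σ = 1`-conjugates of the) theta classes. [cite: MochizukiEtTh2009, Thm 1.6 (iii) p.24] -/
theorem thm16iii_twistedInversion_modelχ :
    ThetaSetting.Thm16iii (twistedInversionTop (chi p) (isInducing_leftRightχ p))
      (isInversionAut_twistedInversion_modelχ p).thm16i cι (etaleThetaDataχSec p (etaDdχ p))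
      (etaleThetaDataχSec p (etaDdχ p)) (compat_modelχ p) :=
  (invClauses_modelχ p cι).thm16iii_self (compat_modelχ p)

/-- **The K3-capstone binder shape `hιx`/`hιy` at `γ = ι`, WITNESSED at the χ-model**: for every lift `x′` of a theta class
`x` and every intertwiner `T` of the Θ-level classes, `T x′ = x′ · κ(u)` with `u ∈ O^×_K̈` (abc-iut-L2-t1's
`InvClauses.thetaLift_fixed`). [cite: MochizukiEtTh2009, Prop 1.5 (iii) p.23] -/
theorem thetaLift_fixed_modelχ
    (T : (ThetaSetting.modelχ p).H1Theta ((ThetaSetting.modelχ p).GtpYdd.map (ThetaSetting.modelχ p).toTheta) ≃*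
      (ThetaSetting.modelχ p).H1Theta ((ThetaSetting.modelχ p).GtpYdd.map (ThetaSetting.modelχ p).toTheta))
    (hT : ∀ z, (ThetaSetting.modelχ p).inflTheta (ThetaSetting.modelχ p).GtpYdd (T z) =
      ThetaSetting.transport cι (isInversionAut_twistedInversion_modelχ p).thm16i
        ((ThetaSetting.modelχ p).inflTheta (ThetaSetting.modelχ p).GtpYdd z))
    {x : (ThetaSetting.modelχ p).H1 (ThetaSetting.modelχ p).GtpYdd}
    (hx : x ∈ (etaleThetaDataχSec p (etaDdχ p)).thetaClasses)
    (x' : (ThetaSetting.modelχ p).H1Theta ((ThetaSetting.modelχ p).GtpYdd.map (ThetaSetting.modelχ p).toTheta))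
    (hx' : (ThetaSetting.modelχ p).inflTheta (ThetaSetting.modelχ p).GtpYdd x' = x) :
    ∃ u ∈ (ThetaSetting.modelχ p).unitsOKdd, ∃ v ∈ (ThetaSetting.modelχ p).unitsOKdd,
      x = (ThetaSetting.modelχ p).inflTheta (ThetaSetting.modelχ p).GtpYdd
          ((etaleThetaDataχSec p (etaDdχ p)).kumYdd ((etaleThetaDataχSec p (etaDdχ p)).toKddHat v)) *
            (etaleThetaDataχSec p (etaDdχ p)).etaDd ∧
        T x' = x' * (etaleThetaDataχSec p (etaDdχ p)).kumYdd ((etaleThetaDataχSec p (etaDdχ p)).toKddHat u) :=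
  (invClauses_modelχ p cι).thetaLift_fixed T hT hx x' hx'

/-- **NV for the typed [EtTh] Thm. 1.6 (iii) at non-degenerate data**: SOME Theta setting of [EtTh] origin carries étale
theta data with `η̈^Θ ≠ 1`, a `Compat` witness, and an automorphism `γ` of `Π^tp_X` with `Thm16i γ` and a theta companion
`c` for which `Thm16iii γ _ c E E hC` holds (the χ-model, its twisted inversion, the quotient-map companion).
[cite: MochizukiEtTh2009, Thm 1.6 (iii) p.24] -/
theorem _root_.Literature.AnabelianGeometry.EtaleTheta.ThetaSetting.exists_isEtThOrigin_thm16iii_ne_one :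
    ∃ (D : ThetaSetting p) (hC : D.Compat) (E : D.EtaleThetaData) (γ : D.PiTemp ≃ₜ* D.PiTemp) (h : ThetaSetting.Thm16i γ)
      (c : ThetaSetting.ThetaCompanion γ), D.IsEtThOrigin ∧ E.etaDd ≠ 1 ∧ ThetaSetting.Thm16iii γ h c E E hC :=
  ⟨ThetaSetting.modelχ p, compat_modelχ p, etaleThetaDataχSec p (etaDdχ p),
    twistedInversionTop (chi p) (isInducing_leftRightχ p), (isInversionAut_twistedInversion_modelχ p).thm16i,
    (ThetaSetting.modelχ p).thetaCompanionOfAut (twistedInversionTop (chi p) (isInducing_leftRightχ p))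
      (map_deltaTemp_twistedInversion_modelχ p) (isQuotientMap_toTheta_modelχ p),
    ThetaSetting.modelχ_isEtThOrigin p, etaDd_etaleThetaDataχSec_etaDdχ_ne_one p, thm16iii_twistedInversion_modelχ p _⟩

end StageOne

/-! ### Stage 2: the Tate-sheared model and its cocycle-corrected inversion (`j = 2i`) -/

section StageTwo

variable (i j : ℤ) (hj : Even j)
  (cι : ThetaSetting.ThetaCompanion (Dα := ThetaSetting.modelχq p i j hj) (Dβ := ThetaSetting.modelχq p i j hj)
    (inversionχq p i j))
  (s : GQp p →* PiTpχq p i j) (hs : Continuous s)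
  (hsec : ∀ σ : GQp p, (ThetaSetting.modelχq p i j hj).aug (s σ) = σ)
  (hsY : (ThetaSetting.modelχq p i j hj).GK.map s ≤ (ThetaSetting.modelχq p i j hj).GtpY)
  (hsYdd : (ThetaSetting.modelχq p i j hj).GKdd.map s ≤ (ThetaSetting.modelχq p i j hj).GtpYdd)

/-- **[EtTh] Thm. 1.6 (iii) HOLDS at `γ := ι` at the stage-2 model when `j = 2i`**, for the section datum of every
Galois section `s` carrying the class of record `etaDdχq`, and every theta companion.
[cite: MochizukiEtTh2009, Thm 1.6 (iii) p.24] -/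
theorem thm16iii_inversionχq_ofSection (h2 : -i + -i + j = 0) :
    ThetaSetting.Thm16iii (inversionχq p i j) (isInversionAut_inversionχq p i j hj).thm16i cι
      (((kummerCoreχq p i j hj).toKummerDataOfSection s hs hsec hsY hsYdd).etaleThetaDataOfClass (etaDdχq p i j hj))
      (((kummerCoreχq p i j hj).toKummerDataOfSection s hs hsec hsY hsYdd).etaleThetaDataOfClass (etaDdχq p i j hj))
      (compat_modelχq p i j hj) :=
  (invClauses_modelχq_ofSection p i j hj cι s hs hsec hsY hsYdd h2).thm16iii_self (compat_modelχq p i j hj)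

end StageTwo

/-- **[EtTh] Thm. 1.6 (iii) at `γ := ι` at the instance of record** `modelχq p 1 2` (Tate shear), section datum of the
Galois factor `inr` (same `E` as abc-iut-L2-t6's `prop15iii_etaleThetaDataOfClass_etaDdχq_inr`), every companion.
[cite: MochizukiEtTh2009, Thm 1.6 (iii) p.24] -/
theorem thm16iii_inversionχq_modelTate_inr
    (cι : ThetaSetting.ThetaCompanion (Dα := ThetaSetting.modelχq p 1 2 even_two)
      (Dβ := ThetaSetting.modelχq p 1 2 even_two) (inversionχq p 1 2)) :
    ThetaSetting.Thm16iii (inversionχq p 1 2) (isInversionAut_inversionχq p 1 2 even_two).thm16i cι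
      (((kummerCoreχq p 1 2 even_two).toKummerDataOfSection (SemidirectProduct.inr : GQp p →* PiTpχq p 1 2)
        (continuous_inrχq p 1 2) (fun _ => rfl)
        (by
          rintro _ ⟨σ, -, rfl⟩
          show (tateTwistData₀ p 1 2).toZ _ = 1
          rw [GfpTwistData₀.toZ_apply, SemidirectProduct.left_inr, map_one])
        (by
          rintro _ ⟨σ, -, rfl⟩
          refine mem_GtpYdd_modelχq_of_hHat_two_y p 1 2 even_two ?_ ?_
          · show (tateTwistData₀ p 1 2).toZ _ = 1
            rw [GfpTwistData₀.toZ_apply, SemidirectProduct.left_inr, map_one]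
          · rw [SemidirectProduct.left_inr, map_one, map_one, Heis.one_y])).etaleThetaDataOfClass
        (etaDdχq p 1 2 even_two))
      (((kummerCoreχq p 1 2 even_two).toKummerDataOfSection (SemidirectProduct.inr : GQp p →* PiTpχq p 1 2)
        (continuous_inrχq p 1 2) (fun _ => rfl)
        (by
          rintro _ ⟨σ, -, rfl⟩
          show (tateTwistData₀ p 1 2).toZ _ = 1
          rw [GfpTwistData₀.toZ_apply, SemidirectProduct.left_inr, map_one])
        (by
          rintro _ ⟨σ, -, rfl⟩
          refine mem_GtpYdd_modelχq_of_hHat_two_y p 1 2 even_two ?_ ?_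
          · show (tateTwistData₀ p 1 2).toZ _ = 1
            rw [GfpTwistData₀.toZ_apply, SemidirectProduct.left_inr, map_one]
          · rw [SemidirectProduct.left_inr, map_one, map_one, Heis.one_y])).etaleThetaDataOfClass
        (etaDdχq p 1 2 even_two))
      (compat_modelχq p 1 2 even_two) :=
  (invClauses_modelTate_inr p cι).thm16iii_self (compat_modelχq p 1 2 even_two)

end Literature.AnabelianGeometry.EtaleTheta.SettingModel

end
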